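import Summits.BirchSwinnertonDyer.BirchSwinnertonDyer.Theorems.CMKolyvaginAtInertTwoSelmerRankOneMazurRubinPrimeR0AtTwo
import Summits.BirchSwinnertonDyer.BirchSwinnertonDyer.Theorems.CMKolyvaginAtInertTwoSilentSupplyOfOneBitSelmerSupply
import Summits.BirchSwinnertonDyer.BirchSwinnertonDyer.Theorems.CMKolyvaginAtInertTwoGenusParityOnHTwo
import HarnessLib

/-!
# Route `CMKolyvaginAtInertTwo` (leaf `WAllCornerFTwo`, habitat H₂) — THE HABITAT PER CELL: on `#Sel₂(E) = 2` R0 at the Mazur–Rubin primes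
# ONLY; off it the one-bit Selmer supply HL′₁ᶜ ∧ R1 ∧ Gross 3.7 (2) ONLY (R0 is provably never invoked there)

Seat `bsd-line-cmk2-p1` g24 (cell `bsd-print-cf2`), `--supports stmt-BirchSwinnertonDyer-28176` (helper; closes nothing by name).
THEOREMS ONLY (no definition, no named fact, no `sorry`).  BSD is NOT proved by this.

§1 `primaryComponent_sha_two_baseChange_ne_bot_of_natCard_selmerGroup_ne_two`: for a framed `W ∈ H₂` (`r_an = 1`) with `#Sel₂(W/ℚ) ≠ 2`
(⟺ `Ш(W/ℚ)(2) ≠ ⊥`, g24 §0) and ANY odd Heegner `K` with `y_K` of infinite order, `Ш(W_K)(2) ≠ ⊥` — from g15's count identity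
`#Ш(W_K)(2)·2 = #Ш(W)(2)·#Ш(W^{(d_K)})(2)·2^{Σ}` and g22's genus parity `Σ ≥ 1` (no Galois-cohomological restriction argument needed).  Hence
on the cell `#Sel₂(E) ≠ 2` the trivial-Ш regime R0 (28176) is VACUOUS and only R1 (28177) is ever used.
§2 `bsdp_two_of_perCellInputs_of_printedInputs`: PER CURVE, `BSDp W 2` from: [`#Sel₂(W) = 2` → R0 at the Mazur–Rubin primes of `W`] and
[`#Sel₂(W) ≠ 2` → (one-bit Heegner `K` + prime `ℓ` with `corank_ℓ Sel(W^{(d_K)}) = 0`) ∧ (R1 at `W` on one-bit fields) ∧ (Gross 3.7 (2) for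
the frames of `W`)], and six prints.
§3 `bsdp_two_onHabitat_of_cellItems_of_printedInputs`: BY (candidate) ITEMS — prints ∧ BT ∧ 28665 ∧ «R0ᴹᴿ» ∧ 28177 ∧ «HL′₁ᶜ» ⟹ the habitat
conjunct; R0ᴹᴿ and HL′₁ᶜ are the texts of `…SelmerRankOneMazurRubinPrimeR0AtTwo` / `…SilentSupplyOfOneBitSelmerSupply` (not items; the
pen's call), each WEAKER than the item it would replace (28176 resp. the prime-twist residual of 28663).

References: [MazurRubin2010] Cor. 3.4 (i); [BurungaleTian2026] Thm. 1.1; [BurungaleFlach2024] Cor. 2; [GrossLMS1991] Prop. 3.7 (2), §11;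
[Kramer1981] Prop. 3; [Milne1972ArithmeticAV] Thm. 1; [McCallumLMS1991] §5.
-/

set_option autoImplicit false
-- the Theorems namespace of this sub repeats the summit name by design (D-0017 nested layout)
set_option linter.dupNamespace false

noncomputable section

open scoped Classical

open WeierstrassCurve NumberField Literature.NumberTheory.EllipticCurves
  Literature.NumberTheory.EllipticCurves.ModularForms
  Literature.NumberTheory.EllipticCurves.Rank1Residual
  Summit.BirchSwinnertonDyer.Rank1Residual
open Literature.NumberTheory.EllipticCurves.GrossLMS1991 (prop37_2_reductionCongruence_inert)
open Summit.BirchSwinnertonDyer.BirchSwinnertonDyer.Theses.CMKolyvaginAtInertTwo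
  (CMKolyvaginDescentOfNontrivialShaTwo Prop37ReductionCongruenceInertAll)

namespace Summit.BirchSwinnertonDyer.BirchSwinnertonDyer.Theorems.KolyvaginLowerTwo

/-! ## §1 Off `#Sel₂(E) = 2`, `Ш(E_K)(2) ≠ ⊥` for every Heegner frame -/

/-- **`Ш(W/ℚ)[2] ≠ 0 ⟹ Ш(W_K)(2) ≠ ⊥`** for `W ∈ H₂` (CM, `2` inert, `ρ̄₂` onto, `r_an = 1`) with `#Sel₂(W/ℚ) ≠ 2`, `K` imaginary quadratic
with odd `d_K` Heegner for `N_W`, and a frame `(Dt, β, ι, d₁)` with `y_K = P(1)` of infinite order (mod GZ, GZK, modularity, Milne):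
g15's count identity `#Ш(W_K)(2)·2 = #Ш(W)(2)·#Ш(W^{(d_K)})(2)·2^{Σ}` with `#Ш(W)(2) ≥ 2` (`Ш(W)(2) ≠ ⊥`, finite by GZK) and `Σ ≥ 1`
(genus parity on H₂, g22) gives `#Ш(W_K)(2) ≥ 2`. [cite: Kramer1981, Prop. 3] [cite: Milne1972ArithmeticAV, Thm. 1] [cite: GrossZagier1986, V.§2] -/
theorem primaryComponent_sha_two_baseChange_ne_bot_of_natCard_selmerGroup_ne_two
    (hGZ : ∀ (N : ℕ) [NeZero N] (W : WeierstrassCurve ℚ) (K : Type) [Field K] [NumberField K], gross_zagier N W K)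
    (hGZK : rank_eq_analyticRank_of_analyticRank_le_one) (hnf : exists_isNewformOf)
    (hMilneC : Milne1972.bsdQuotient_baseChange_quadratic_anyModel)
    (W : WeierstrassCurve ℚ) [W.IsElliptic] [W.IsGloballyMinimal] [NeZero (W.conductorNorm ℤ)]
    (hCM : W.HasCM) (hin : Rank1Residual.CMInert W 2) (hρ2 : W.HasSurjectiveModNGaloisRep 2) (hr : W.analyticRank = 1)
    (hSel : Nat.card (W.selmerGroup 2) ≠ 2)
    (K : Type) [Field K] [NumberField K] (hK : IsImaginaryQuadratic K) (hodd : Odd (NumberField.discr K))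
    (hH : SatisfiesHeegnerHypothesis (W.conductorNorm ℤ) K)
    (Dt : ModularParametrizationData W (W.conductorNorm ℤ)) (β : ℤ) (ι : K →+* ℂ) (d₁ : KolyvaginHeegnerData Dt β ι 1)
    (hy : ¬ IsOfFinAddOrder d₁.derivedPoint) :
    AddCommGroup.primaryComponent (W.baseChange K).sha 2 ≠ ⊥ := by
  haveI : Fact (Nat.Prime 2) := ⟨Nat.prime_two⟩
  have hmod : hasEntireLFunction_rat := hasEntireLFunction_rat_of_exists_isNewformOf hnf
  have hΔ : W.Δ < 0 := KolyvaginEigenTwo.Δ_neg_of_cmInert_two W hCM hin hρ2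
  -- `Ш(W)(2) ≠ ⊥`, finite: card `≥ 2`
  have hShaW : AddCommGroup.primaryComponent W.sha 2 ≠ ⊥ :=
    fun h ↦ hSel ((natCard_selmerGroup_two_eq_two_iff_primaryComponent_sha_two_eq_bot hGZK W hρ2 hr).mpr h)
  haveI hfinW : Finite W.sha := (hGZK W (by rw [hr])).2
  have hB1 : 1 ≤ Nat.card (AddCommGroup.primaryComponent W.sha 2) := Nat.one_le_iff_ne_zero.mpr Nat.card_pos.ne'
  have hB : 2 ≤ Nat.card (AddCommGroup.primaryComponent W.sha 2) := by
    by_contra hlt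
    exact hShaW (AddSubgroup.eq_bot_of_card_eq _ (by omega))
  -- genus parity: `Σ ≥ 1`
  have hSig := GenusParityTwo.genusParityOnHTwo W hCM hin hρ2 K hK hodd hH
  -- the count identity
  obtain ⟨hfinK, hid⟩ := ShaCountTwo.card_primaryComponent_sha_two_baseChange_mul_two_eq_of_heegnerData_of_facts hGZ hGZK hmod hMilneC
    W hρ2 K hK hodd hH Dt β ι d₁ hy
  rw [if_neg (not_lt.mpr hΔ.le), one_mul] at hid
  set A := Nat.card (AddCommGroup.primaryComponent (W.baseChange K).sha 2) with hA
  set B := Nat.card (AddCommGroup.primaryComponent W.sha 2) with hBdef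
  set C := Nat.card (AddCommGroup.primaryComponent (W.quadraticTwist (NumberField.discr K : ℚ)).sha 2) with hCdef
  set S := ∑ q ∈ (NumberField.discr K).natAbs.primeFactors,
    ((if jacobiSym W.Δ.num q = -1 then 1 else 0) + (if jacobiSym W.Δ.num q = 1 ∧ Even (W.frobeniusTrace q) then 2 else 0)) with hS
  haveI : Finite (W.baseChange K).sha := hfinK
  have hA1 : 1 ≤ A := Nat.one_le_iff_ne_zero.mpr Nat.card_pos.ne'
  have hC1 : 1 ≤ C := by
    rcases Nat.eq_zero_or_pos C with h0 | h0
    · rw [h0, mul_zero, zero_mul] at hid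
      omega
    · exact h0
  have hpow : 2 ≤ 2 ^ S := by
    calc (2 : ℕ) = 2 ^ 1 := (pow_one 2).symm
      _ ≤ 2 ^ S := Nat.pow_le_pow_right (by norm_num) hSig
  have hBC : 2 ≤ B * C := le_trans (by norm_num) (Nat.mul_le_mul hB hC1)
  have h4 : 4 ≤ B * C * 2 ^ S := le_trans (by norm_num) (Nat.mul_le_mul hBC hpow)
  have hA2 : 2 ≤ A := by
    rw [← hid] at h4
    omega
  intro hbot
  rw [hA, hbot, AddSubgroup.card_bot] at hA2
  omega

/-! ## §2 Per curve, per cell -/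

/-- **`BSD₂(E)` for ONE framed `E ∈ H₂` from its CELL's inputs only** (six prints: GZ, GZK, modularity, Milne any-model, Burungale–Flach,
Burungale–Tian).  On `#Sel₂(W) = 2`: R0 at the Mazur–Rubin primes of `W` (`hMR`, the hypothesis text of g24's
`bsdp_two_of_natCard_selmerGroup_eq_two_of_mazurRubinPrimeR0_of_printedInputs`).  On `#Sel₂(W) ≠ 2`: a one-bit Heegner field `K` with a prime
`ℓ` of Selmer corank `0` for `W^{(d_K)}` (`hHL`), R1 at `W` on one-bit fields (`hR1`), and Gross 3.7 (2) for the frames of `W` (`h37`) —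
R0 is NOT needed there (§1: `Ш(W_K)(2) ≠ ⊥` automatically).  CONDITIONAL on the displayed inputs; closes nothing; BSD is NOT proved.
[cite: MazurRubin2010, Cor. 3.4 (i)] [cite: BurungaleTian2026, Thm. 1.1] [cite: GrossLMS1991, §11 and Prop. 3.7 (2)] [cite: McCallumLMS1991, §5 Thm. 5.4]
[cite: BurungaleFlach2024, Cor. 2] -/
theorem bsdp_two_of_perCellInputs_of_printedInputs
    (hGZ : ∀ (N : ℕ) [NeZero N] (W : WeierstrassCurve ℚ) (K : Type) [Field K] [NumberField K], gross_zagier N W K)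
    (hGZK : rank_eq_analyticRank_of_analyticRank_le_one) (hnf : exists_isNewformOf)
    (hMilneC : Milne1972.bsdQuotient_baseChange_quadratic_anyModel) (hBF : bsdTriple_of_hasCM_of_L_one_ne_zero)
    (hBT : burungaleTian_analyticRank_eq_zero_of_selmerCorank_eq_zero_of_hasCM)
    (W : WeierstrassCurve ℚ) [W.IsElliptic] [W.IsGloballyMinimal] [NeZero (W.conductorNorm ℤ)]
    (hCM : W.HasCM) (hin : Rank1Residual.CMInert W 2) (hρ2 : W.HasSurjectiveModNGaloisRep 2) (hr : W.analyticRank = 1)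
    (hT : Odd W.tamagawaProduct)
    (hopt : ∃ Dt : ModularParametrizationData W (W.conductorNorm ℤ),
      (∀ z ∈ Dt.L.lattice, ∃ w ∈ periodLattice Dt.f, z = (Dt.c : ℂ) * w) ∧ Odd Dt.c)
    (hMR : Nat.card (W.selmerGroup 2) = 2 → ∀ (ℓ : ℕ) [Fact ℓ.Prime], ℓ % 8 = 7 → (4 * W.conductorNorm ℤ : ℕ) ∣ ℓ + 1 →
      ¬ W.selmerGroup 2 ≤ MazurRubin2010.strictLocalKer W ℚ_[ℓ] 2 →
      ∀ (K : Type) [Field K] [NumberField K], IsImaginaryQuadratic K → NumberField.discr K = -(ℓ : ℤ) →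
      SatisfiesHeegnerHypothesis (W.conductorNorm ℤ) K → ((Ideal.span {(2 : ℤ)}).primesOver (𝓞 K)).ncard = 2 →
      ∀ (Dt : ModularParametrizationData W (W.conductorNorm ℤ)),
      (∀ z ∈ Dt.L.lattice, ∃ w ∈ periodLattice Dt.f, z = (Dt.c : ℂ) * w) → Odd Dt.c →
      ∀ (β : ℤ) (ι : K →+* ℂ) (d₁ : KolyvaginHeegnerData Dt β ι 1), ¬ IsOfFinAddOrder d₁.derivedPoint →
      ¬ ∃ Q : (W.baseChange (ringClassField K ι 1)).toAffine.Point, (2 : ℤ) • Q = d₁.derivedPoint)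
    (hHL : Nat.card (W.selmerGroup 2) ≠ 2 →
      ∃ (K : Type) (_ : Field K) (_ : NumberField K), IsImaginaryQuadratic K ∧ Odd (NumberField.discr K) ∧
        NumberField.discr K ≠ -3 ∧ SatisfiesHeegnerHypothesis (W.conductorNorm ℤ) K ∧
        (∑ q ∈ (NumberField.discr K).natAbs.primeFactors,
          ((if jacobiSym W.Δ.num q = -1 then 1 else 0) + (if jacobiSym W.Δ.num q = 1 ∧ Even (W.frobeniusTrace q) then 2 else 0)) ≤ 1) ∧
        ∃ ℓ : ℕ, ℓ.Prime ∧ (W.quadraticTwist (NumberField.discr K : ℚ)).selmerCorank ℓ = 0)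
    (hR1 : Nat.card (W.selmerGroup 2) ≠ 2 → ∀ (K : Type) [Field K] [NumberField K], IsImaginaryQuadratic K →
      Odd (NumberField.discr K) → NumberField.discr K ≠ -3 → SatisfiesHeegnerHypothesis (W.conductorNorm ℤ) K →
      (∑ q ∈ (NumberField.discr K).natAbs.primeFactors, ((if jacobiSym W.Δ.num q = -1 then 1 else 0) +
        (if jacobiSym W.Δ.num q = 1 ∧ Even (W.frobeniusTrace q) then 2 else 0)) ≤ 1) →
      ∀ (Dt : ModularParametrizationData W (W.conductorNorm ℤ)),
      (∀ z ∈ Dt.L.lattice, ∃ w ∈ periodLattice Dt.f, z = (Dt.c : ℂ) * w) → Odd Dt.c →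
      ∀ (β : ℤ) (ι : K →+* ℂ) (d₁ : KolyvaginHeegnerData Dt β ι 1), ¬ IsOfFinAddOrder d₁.derivedPoint →
      AddCommGroup.primaryComponent (W.baseChange K).sha 2 ≠ ⊥ →
      ∃ (n : ℕ) (d : KolyvaginHeegnerData Dt β ι n), Squarefree n ∧
        (∀ ℓ ∈ n.primeFactors, Zhang2014.IsKolyvaginPrime (W.conductorNorm ℤ) W K 2 ℓ ∧ Rank1Residual.CMInert W ℓ) ∧
        ¬ ∃ Q : (W.baseChange (ringClassField K ι n)).toAffine.Point, (2 : ℤ) • Q = d.derivedPoint)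
    (h37 : Nat.card (W.selmerGroup 2) ≠ 2 → ∀ (K : Type) [Field K] [NumberField K],
      prop37_2_reductionCongruence_inert (W.conductorNorm ℤ) W K) :
    BSDp W 2 := by
  by_cases hSel : Nat.card (W.selmerGroup 2) = 2
  · exact bsdp_two_of_natCard_selmerGroup_eq_two_of_mazurRubinPrimeR0_of_printedInputs hGZ hGZK hnf hMilneC hBF hBT W hCM hin hρ2 hr hT
      hopt hSel (hMR hSel)
  · have hmod : hasEntireLFunction_rat := hasEntireLFunction_rat_of_exists_isNewformOf hnf
    obtain ⟨K, _, _, hK, hodd, h3, hH, hdef, ℓ, hℓ, h0⟩ := hHL hSel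
    have hd0 : ((NumberField.discr K : ℤ) : ℚ) ≠ 0 := by exact_mod_cast NumberField.discr_ne_zero K
    have hL : (W.quadraticTwist (NumberField.discr K : ℚ)).entireLFunction 1 ≠ 0 :=
      entireLFunction_twist_ne_zero_of_selmerCorank_eq_zero hBT hmod W hCM hd0 hℓ h0
    -- the frame
    obtain ⟨Dt, hDt, hc⟩ := hopt
    obtain ⟨β, hβ⟩ := exists_dvd_sq_sub_discr_holds (W.conductorNorm ℤ) K hK hH
    let ι : K →+* ℂ := Classical.choice inferInstance
    obtain ⟨d₁⟩ := exists_kolyvaginHeegnerData_one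
      (phi_heegnerTau_mem_singularModuliField_holds (W.conductorNorm ℤ) W K) hK Dt β ι hβ
    have hy : ¬ IsOfFinAddOrder d₁.derivedPoint :=
      CMSupply.not_isOfFinAddOrder_derivedPoint_one_of_rankOne hnf W K (hGZ _ W K) hK hH hr hL d₁
    -- off SEL2 the non-trivial-Ш regime is forced (§1); R1 gives the certificate
    have hne : AddCommGroup.primaryComponent (W.baseChange K).sha 2 ≠ ⊥ :=
      primaryComponent_sha_two_baseChange_ne_bot_of_natCard_selmerGroup_ne_two hGZ hGZK hnf hMilneC W hCM hin hρ2 hr hSel K hK hodd hH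
        Dt β ι d₁ hy
    have hcert := hR1 hSel K hK hodd h3 hH hdef Dt hDt hc β ι d₁ hy hne
    exact bsdp_two_of_exists_certificate_of_sum_defect_le_one_of_printedInputs hGZ hGZK hnf hMilneC hBF W hCM hin hρ2 hr hT K hK hodd
      h3 hH hdef (h37 hSel K) Dt hDt hc β ι d₁ hy hcert

/-! ## §3 By (candidate) items: prints ∧ BT ∧ 28665 ∧ «R0 at the Mazur–Rubin primes» ∧ 28177 ∧ «HL′₁ᶜ» ⟹ the habitat conjunct -/

/-- **THE HABITAT FROM THE CELL ITEMS.**  Binders: six prints (GZ, GZK, modularity, Milne, Burungale–Flach, Burungale–Tian), Gross 3.7 (2) for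
all frames (`Prop37ReductionCongruenceInertAll`, 28665), «R0ᴹᴿ» = «∀ W ∈ H₂ with `#Sel₂(W) = 2`, R0 at the Mazur–Rubin primes of W» (a text,
weaker than 28176), `CMKolyvaginDescentOfNontrivialShaTwo` (28177), and «HL′₁ᶜ» (the one-bit-field Selmer residual of 28663, a text).
Conclusion: `BSDp W 2` for every framed `W ∈ H₂`.  CONDITIONAL; closes nothing by name; BSD is NOT proved by this.
[cite: MazurRubin2010, Cor. 3.4 (i)] [cite: BurungaleTian2026, Thm. 1.1] [cite: GrossLMS1991, Prop. 3.7 (2)] [cite: BurungaleFlach2024, Cor. 2] -/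
theorem bsdp_two_onHabitat_of_cellItems_of_printedInputs
    (hGZ : ∀ (N : ℕ) [NeZero N] (W : WeierstrassCurve ℚ) (K : Type) [Field K] [NumberField K], gross_zagier N W K)
    (hGZK : rank_eq_analyticRank_of_analyticRank_le_one) (hnf : exists_isNewformOf)
    (hMilneC : Milne1972.bsdQuotient_baseChange_quadratic_anyModel) (hBF : bsdTriple_of_hasCM_of_L_one_ne_zero)
    (hBT : burungaleTian_analyticRank_eq_zero_of_selmerCorank_eq_zero_of_hasCM) (h37 : Prop37ReductionCongruenceInertAll)
    (hR0MR : ∀ (W : WeierstrassCurve ℚ) [W.IsElliptic] [W.IsGloballyMinimal] [NeZero (W.conductorNorm ℤ)], W.HasCM →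
      Rank1Residual.CMInert W 2 → W.HasSurjectiveModNGaloisRep (2 : ℤ) → W.analyticRank = 1 → Odd W.tamagawaProduct →
      Nat.card (W.selmerGroup 2) = 2 → ∀ (ℓ : ℕ) [Fact ℓ.Prime], ℓ % 8 = 7 → (4 * W.conductorNorm ℤ : ℕ) ∣ ℓ + 1 →
      ¬ W.selmerGroup 2 ≤ MazurRubin2010.strictLocalKer W ℚ_[ℓ] 2 →
      ∀ (K : Type) [Field K] [NumberField K], IsImaginaryQuadratic K → NumberField.discr K = -(ℓ : ℤ) →
      SatisfiesHeegnerHypothesis (W.conductorNorm ℤ) K → ((Ideal.span {(2 : ℤ)}).primesOver (𝓞 K)).ncard = 2 →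
      ∀ (Dt : ModularParametrizationData W (W.conductorNorm ℤ)),
      (∀ z ∈ Dt.L.lattice, ∃ w ∈ periodLattice Dt.f, z = (Dt.c : ℂ) * w) → Odd Dt.c →
      ∀ (β : ℤ) (ι : K →+* ℂ) (d₁ : KolyvaginHeegnerData Dt β ι 1), ¬ IsOfFinAddOrder d₁.derivedPoint →
      ¬ ∃ Q : (W.baseChange (ringClassField K ι 1)).toAffine.Point, (2 : ℤ) • Q = d₁.derivedPoint)
    (hR1 : CMKolyvaginDescentOfNontrivialShaTwo)
    (hHL₁ : ∀ (W : WeierstrassCurve ℚ) [W.IsElliptic] [W.IsGloballyMinimal] [NeZero (W.conductorNorm ℤ)],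
      W.HasCM → Rank1Residual.CMInert W 2 → W.HasSurjectiveModNGaloisRep (2 : ℤ) → W.analyticRank = 1 →
      Nat.card (W.selmerGroup 2) ≠ 2 →
      ∃ (K : Type) (_ : Field K) (_ : NumberField K), IsImaginaryQuadratic K ∧ Odd (NumberField.discr K) ∧
        NumberField.discr K ≠ -3 ∧ SatisfiesHeegnerHypothesis (W.conductorNorm ℤ) K ∧
        (∑ q ∈ (NumberField.discr K).natAbs.primeFactors,
          ((if jacobiSym W.Δ.num q = -1 then 1 else 0) + (if jacobiSym W.Δ.num q = 1 ∧ Even (W.frobeniusTrace q) then 2 else 0)) ≤ 1) ∧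
        ∃ ℓ : ℕ, ℓ.Prime ∧ (W.quadraticTwist (NumberField.discr K : ℚ)).selmerCorank ℓ = 0)
    (W : WeierstrassCurve ℚ) [W.IsElliptic] [W.IsGloballyMinimal] [NeZero (W.conductorNorm ℤ)]
    (hCM : W.HasCM) (hin : Rank1Residual.CMInert W 2) (hρ2 : W.HasSurjectiveModNGaloisRep 2) (hr : W.analyticRank = 1)
    (hT : Odd W.tamagawaProduct)
    (hopt : ∃ Dt : ModularParametrizationData W (W.conductorNorm ℤ),
      (∀ z ∈ Dt.L.lattice, ∃ w ∈ periodLattice Dt.f, z = (Dt.c : ℂ) * w) ∧ Odd Dt.c) :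
    BSDp W 2 :=
  bsdp_two_of_perCellInputs_of_printedInputs hGZ hGZK hnf hMilneC hBF hBT W hCM hin hρ2 hr hT hopt
    (fun hSel ℓ _ hℓ8 hdvd hns K _ _ hK hd hH h2K Dt hDt hc β ι d₁ hy ↦
      hR0MR W hCM hin hρ2 hr hT hSel ℓ hℓ8 hdvd hns K hK hd hH h2K Dt hDt hc β ι d₁ hy)
    (fun hSel ↦ hHL₁ W hCM hin hρ2 hr hSel)
    (fun _ K _ _ hK hodd h3 hH _ Dt hDt hc β ι d₁ hy hne ↦ hR1 W hCM hin hρ2 hr hT K hK hodd h3 hH Dt hDt hc β ι d₁ hy hne)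
    (fun _ K _ _ ↦ h37 W K)

end Summit.BirchSwinnertonDyer.BirchSwinnertonDyer.Theorems.KolyvaginLowerTwo

end
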